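import Literature.Probability.Percolation.MeanFieldBetaFromGamma
import Literature.Probability.LatticeModels.RandomClusterShiftedBoxes
import Literature.Probability.LatticeModels.RandomClusterDomainToBox
import Mathlib.MeasureTheory.MeasurableSpace.NCard
import HarnessLib

/-!
# FK-continuity cell, FO-10a: `{|C_x| ≥ k}` has a LOCAL increasing proxy, and the cluster density `∫ |C_x|⁻¹` is within `1/N`
# of a finite combination of the probabilities `P(|C_x| ≥ k)`, `2 ≤ k ≤ N` (tools for the parameter-continuity of `κ`)

Registered R82 (cell INBOX l.5940, 2026-08-24); registry row FO-10a-g337p; label PCT-C (coordinator fk-4 g175).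
Cell `fk-continuity` (bschramm), row FO-10a (domain-Markov + comparison layer over FO-06); support file for the
FK-continuity transplant (`--supports stmt-CriticalPhenomena-4575`); builds on p205010 (kernel theorem, internal audit
signed; external expert review pending). Pure proofs; no definitions, no named facts, no sorries; general `d` (the
deterministic and measure-level lemmas are stated for an arbitrary countable vertex type where possible).

`|C_x|⁻¹` (Lean: `((openCluster ω x).ncard : ℝ)⁻¹`, `= 0` on an infinite cluster — Grimmett's `|C|⁻¹` with `1/∞ = 0`) is not a
local function. Two facts make it tractable by local monotone methods:
(1) on lattice configurations (`ω ⊆ E(ℤ^d)`, which carry every random-cluster measure) the increasing event `{|C_x| ≥ k}`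
(Literature `clusterSizeGe`, `encard`-valued) is decided inside the box `Λ_{m+k}` when `x ∈ Λ_m`: a cluster with `≥ k` vertices
contains a connected `k`-set through `x` inside that box, grown one open lattice edge at a time (`Walk.exists_boundary_dart` +
`connected_induce_union`); (2) `1/min(|C_x|, N) = 1 − Σ_{k=2}^{N} 1{|C_x| ≥ k}/((k−1)k)` (telescoping) is within `1/N` of `|C_x|⁻¹`.

* (lattice step `mem_box_succ_of_adj` REUSED from Literature `RandomClusterDomainToBox.lean`); **`exists_finset_connected_of_le_encard_openCluster`**; **`le_encard_openCluster_inter_edgesIn_iff`**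
  (`k ≤ |C_x(ω ∩ E_{Λ_{m+k}})| ↔ k ≤ |C_x(ω)|` for `ω ⊆ E(ℤ^d)`, `x ∈ Λ_m`);
* `sum_Icc_inv_mul_eq` (`Σ_{k=2}^{M} 1/((k−1)k) = 1 − 1/M`), `sum_Icc_indicator_clusterSizeGe_eq`, **`abs_inv_ncard_sub_le`**
  (`| |C_x|⁻¹ − (1 − Σ_{k=2}^{N} 1{|C_x| ≥ k}/((k−1)k)) | ≤ 1/N`), `measurable_inv_ncard_openCluster'`, `integrable_inv_ncard_openCluster'`,
  **`abs_integral_inv_ncard_sub_le`** (`|∫ |C_x|⁻¹ dP − (1 − Σ_{k=2}^{N} P(|C_x| ≥ k)/((k−1)k))| ≤ 1/N`, every probability measure `P`).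

Honest framing: deterministic / measure-theoretic tools; no statement about `p_c(q)`; NOT a binder discharge, NOT `_r4`.

## References

* G. Grimmett, *The Random-Cluster Model*, Springer 2006 (`book:grimmett2006-random-cluster-model`): (4.84), Lemma (4.79),
  Prop. (4.85) [PDF pp. 92–95] (the observable `|C|⁻¹`); G. Grimmett, *Percolation*, 2nd ed. 1999, §1.4 (`{|C| ≥ n} ↓ {|C| = ∞}`).
  [Grimmett2006] [GrimmettPercolation1999]
-/

noncomputable section

open MeasureTheory Set Filter
open scoped Topology ENNReal

namespace Summit.CriticalPhenomena.PercolationContinuityZ3.Theorems.FK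

open Literature.Probability.Percolation Literature.Probability.LatticeModels

variable {d : ℕ}

/-- **Growing a connected open set through `x`, one open lattice edge at a time**: for a lattice configuration `ω`
(`ω ⊆ E(ℤ^d)`), `x ∈ Λ_m` and `1 ≤ k ≤ |C_x(ω)|`, there is a finite `S ∋ x` with `|S| = k`, `S ⊆ Λ_{m+k}`, connected in the
open graph of `ω`. [folklore] -/
theorem exists_finset_connected_of_le_encard_openCluster {ω : BondConfig (Site d)} (hω : ω ⊆ (zdGraph d).edgeSet) {m : ℕ}
    {x : Site d} (hx : x ∈ box d m) {k : ℕ} (hk : 1 ≤ k) (hkC : (k : ℕ∞) ≤ (openCluster ω x).encard) :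
    ∃ S : Finset (Site d), x ∈ S ∧ S.card = k ∧ (↑S : Set (Site d)) ⊆ ↑(box d (m + k)) ∧
      ((openGraph ω).induce (↑S : Set (Site d))).Connected := by
  induction k, hk using Nat.le_induction with
  | base =>
    refine ⟨{x}, Finset.mem_singleton_self x, Finset.card_singleton x, ?_, ?_⟩
    · simpa using box_mono d (Nat.le_add_right m 1) hx
    · rw [Finset.coe_singleton]
      haveI : Nonempty (↥({x} : Set (Site d))) := ⟨⟨x, Set.mem_singleton x⟩⟩
      exact ⟨SimpleGraph.Preconnected.of_subsingleton⟩
  | succ k hk ih =>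
    obtain ⟨S, hxS, hScard, hSbox, hSconn⟩ := ih (le_trans (by exact_mod_cast Nat.le_succ k) hkC)
    have hnot : ¬ openCluster ω x ⊆ ↑S := by
      intro hsub
      have h1 : (openCluster ω x).encard ≤ (S : Set (Site d)).encard := Set.encard_le_encard hsub
      rw [Set.encard_coe_eq_coe_finsetCard, hScard] at h1
      have h2 := hkC.trans h1
      norm_cast at h2
      omega
    obtain ⟨z, hzC, hzS⟩ := Set.not_subset.1 hnot
    obtain ⟨w⟩ : (openGraph ω).Reachable x z := hzC
    obtain ⟨e, -, heS, heS'⟩ := w.exists_boundary_dart (↑S : Set (Site d)) (Finset.mem_coe.2 hxS) hzS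
    have hadj : (openGraph ω).Adj e.fst e.snd := e.adj
    have hlat : (zdGraph d).Adj e.fst e.snd := by
      have h1 : s(e.fst, e.snd) ∈ ω := ((openGraph_adj ω _ _).1 hadj).1
      exact (SimpleGraph.mem_edgeSet _).1 (hω h1)
    refine ⟨insert e.snd S, Finset.mem_insert_of_mem hxS, ?_, ?_, ?_⟩
    · rw [Finset.card_insert_of_notMem (fun h => heS' (Finset.mem_coe.2 h)), hScard]
    · rw [Finset.coe_insert]
      refine Set.insert_subset ?_ (hSbox.trans (Finset.coe_subset.2 (box_mono d (by omega))))
      have hv : e.fst ∈ box d (m + k) := hSbox heS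
      simpa [Nat.add_assoc] using mem_box_succ_of_adj hlat hv
    · rw [Finset.coe_insert, Set.insert_eq, Set.union_comm]
      haveI : Nonempty (↥({e.snd} : Set (Site d))) := ⟨⟨e.snd, Set.mem_singleton _⟩⟩
      exact SimpleGraph.connected_induce_union hSconn.preconnected SimpleGraph.Preconnected.of_subsingleton heS
        (Set.mem_singleton _) hadj

/-- **`k ≤ |C_x(ω)|` is decided inside the box `Λ_{m+k}`** for lattice configurations: with `F = E_{Λ_{m+k}}` (the lattice
edges inside the box), `k ≤ |C_x(ω ∩ F)| ↔ k ≤ |C_x(ω)|` (`ω ⊆ E(ℤ^d)`, `x ∈ Λ_m`). [folklore] -/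
theorem le_encard_openCluster_inter_edgesIn_iff {ω : BondConfig (Site d)} (hω : ω ⊆ (zdGraph d).edgeSet) {m : ℕ}
    {x : Site d} (hx : x ∈ box d m) (k : ℕ) :
    (k : ℕ∞) ≤ (openCluster (ω ∩ ↑(edgesIn (zdGraph d) (box d (m + k)))) x).encard ↔
      (k : ℕ∞) ≤ (openCluster ω x).encard := by
  refine ⟨fun h => h.trans (Set.encard_le_encard (openCluster_mono Set.inter_subset_left x)), fun h => ?_⟩
  rcases Nat.eq_zero_or_pos k with rfl | hk
  · simp
  obtain ⟨S, hxS, hScard, hSbox, hSconn⟩ := exists_finset_connected_of_le_encard_openCluster hω hx hk h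
  -- `S ⊆ C_x(ω ∩ F)`: the open edges inside `S` are lattice edges of the box
  set F : Finset (Sym2 (Site d)) := edgesIn (zdGraph d) (box d (m + k)) with hF
  have hle : (openGraph ω).induce (↑S : Set (Site d)) ≤ (openGraph (ω ∩ ↑F)).induce (↑S : Set (Site d)) := by
    intro u v huv
    simp only [SimpleGraph.comap_adj, Function.Embedding.coe_subtype, openGraph_adj] at huv ⊢
    refine ⟨⟨huv.1, ?_⟩, huv.2⟩
    rw [Finset.mem_coe, hF, mem_edgesIn_iff]
    exact ⟨(SimpleGraph.mem_edgeSet _).1 (hω huv.1), fun z hz => by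
      rcases Sym2.mem_iff.1 hz with rfl | rfl
      · exact hSbox u.2
      · exact hSbox v.2⟩
  have hconn := hSconn.mono hle
  have hsub : (↑S : Set (Site d)) ⊆ openCluster (ω ∩ ↑F) x := by
    intro y hy
    have hr := hconn.preconnected ⟨x, Finset.mem_coe.2 hxS⟩ ⟨y, hy⟩
    exact hr.map (SimpleGraph.Embedding.induce (↑S : Set (Site d))).toHom
  calc (k : ℕ∞) = (S : Set (Site d)).encard := by rw [Set.encard_coe_eq_coe_finsetCard, hScard]
    _ ≤ _ := Set.encard_le_encard hsub

/-! ### The local approximants `1 − Σ_{k=2}^{N} 1{|C_x| ≥ k}/((k−1)k) = 1/min(|C_x|, N)` -/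

section Approximants

variable {V : Type*}

/-- The telescoping sum: for `1 ≤ M`, `Σ_{k=2}^{M} 1/((k−1)k) = 1 − 1/M`. [folklore] -/
theorem sum_Icc_inv_mul_eq (M : ℕ) (hM : 1 ≤ M) :
    ∑ k ∈ Finset.Icc 2 M, (1 : ℝ) / (((k : ℝ) - 1) * k) = 1 - 1 / M := by
  induction M, hM using Nat.le_induction with
  | base => simp
  | succ M hM ih =>
    rw [Finset.sum_Icc_succ_top (by omega), ih]
    have hM0 : (M : ℝ) ≠ 0 := by exact_mod_cast (by omega : M ≠ 0)
    have hM1 : ((M : ℝ) + 1) ≠ 0 := by positivity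
    push_cast
    rw [add_sub_cancel_right]
    field_simp
    ring

open Classical in
/-- **Pointwise: `Σ_{k=2}^{N} 1{|C_x(ω)| ≥ k}/((k−1)k) = 1 − 1/min(N, |C_x(ω)|)`** (`N ≥ 1`; `min(N, ∞) = N`). [folklore] -/
theorem sum_Icc_indicator_clusterSizeGe_eq (x : V) (ω : BondConfig V) (N : ℕ) (hN : 1 ≤ N) :
    ∑ k ∈ Finset.Icc 2 N, (if ω ∈ clusterSizeGe x k then (1 : ℝ) / (((k : ℝ) - 1) * k) else 0) =
      1 - 1 / ((if (openCluster ω x).Finite then min N (openCluster ω x).ncard else N : ℕ) : ℝ) := by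
  -- `M(ω)` := the truncated cluster size
  have hx : x ∈ openCluster ω x := mem_openCluster_self ω x
  induction N, hN using Nat.le_induction with
  | base =>
    have : (if (openCluster ω x).Finite then min 1 (openCluster ω x).ncard else 1 : ℕ) = 1 := by
      split_ifs with hfin
      · have h1 : 1 ≤ (openCluster ω x).ncard := Nat.one_le_iff_ne_zero.2 (by
          intro h0; exact absurd ((Set.ncard_eq_zero hfin).1 h0 ▸ hx) (Set.notMem_empty x))
        omega
      · rfl
    simp [this]
  | succ N hN ih =>
    rw [Finset.sum_Icc_succ_top (by omega), ih]
    by_cases hfin : (openCluster ω x).Finite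
    · have hmem : ω ∈ clusterSizeGe x (N + 1) ↔ N + 1 ≤ (openCluster ω x).ncard := by
        rw [mem_clusterSizeGe, ← Set.Finite.cast_ncard_eq hfin]; exact_mod_cast Iff.rfl
      simp only [hfin, ↓reduceIte]
      by_cases hle : N + 1 ≤ (openCluster ω x).ncard
      · rw [if_pos (hmem.2 hle), Nat.min_eq_left (by omega : N ≤ (openCluster ω x).ncard), Nat.min_eq_left hle]
        have hN0 : (N : ℝ) ≠ 0 := by exact_mod_cast (by omega : N ≠ 0)
        have hN1 : ((N : ℝ) + 1) ≠ 0 := by positivity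
        push_cast
        rw [add_sub_cancel_right]
        field_simp
        ring
      · rw [if_neg (fun h => hle (hmem.1 h)), add_zero]
        have hle' := not_le.1 hle
        rw [Nat.min_eq_right (by omega : (openCluster ω x).ncard ≤ N), Nat.min_eq_right (by omega)]
    · have hmem : ω ∈ clusterSizeGe x (N + 1) := by
        rw [mem_clusterSizeGe, Set.encard_eq_top_iff.2 hfin]; exact le_top
      simp only [hfin, ↓reduceIte, hmem]
      have hN0 : (N : ℝ) ≠ 0 := by exact_mod_cast (by omega : N ≠ 0)
      have hN1 : ((N : ℝ) + 1) ≠ 0 := by positivity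
      push_cast
      rw [add_sub_cancel_right]
      field_simp
      ring

open Classical in
/-- **`| |C_x|⁻¹ − (1 − Σ_{k=2}^{N} 1{|C_x| ≥ k}/((k−1)k)) | ≤ 1/N`** pointwise (`N ≥ 1`). [folklore] -/
theorem abs_inv_ncard_sub_le (x : V) (ω : BondConfig V) (N : ℕ) (hN : 1 ≤ N) :
    |((openCluster ω x).ncard : ℝ)⁻¹ -
        (1 - ∑ k ∈ Finset.Icc 2 N, (if ω ∈ clusterSizeGe x k then (1 : ℝ) / (((k : ℝ) - 1) * k) else 0))| ≤
      1 / N := by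
  rw [sum_Icc_indicator_clusterSizeGe_eq x ω N hN, sub_sub_cancel]
  have hx : x ∈ openCluster ω x := mem_openCluster_self ω x
  have hNpos : (0 : ℝ) < N := by exact_mod_cast hN
  split_ifs with hfin
  · have hn : 1 ≤ (openCluster ω x).ncard := Nat.one_le_iff_ne_zero.2 (by
      intro h0; exact absurd ((Set.ncard_eq_zero hfin).1 h0 ▸ hx) (Set.notMem_empty x))
    by_cases hle : (openCluster ω x).ncard ≤ N
    · rw [Nat.min_eq_right hle, one_div, sub_self, abs_zero]; positivity
    · have hle := not_le.1 hle
      rw [Nat.min_eq_left hle.le]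
      have hn' : (N : ℝ) < (openCluster ω x).ncard := by exact_mod_cast hle
      rw [abs_sub_comm, abs_of_nonneg (by rw [one_div, sub_nonneg]; exact inv_anti₀ hNpos hn'.le)]
      have : 0 ≤ ((openCluster ω x).ncard : ℝ)⁻¹ := by positivity
      linarith
  · rw [Set.Infinite.ncard hfin, Nat.cast_zero, inv_zero, zero_sub, abs_neg, abs_of_nonneg (by positivity)]

end Approximants

/-- `ω ↦ |C_x(ω)|⁻¹` is measurable. [folklore] -/
theorem measurable_inv_ncard_openCluster' {V : Type*} [Countable V] (x : V) :
    Measurable fun ω : BondConfig V => ((openCluster ω x).ncard : ℝ)⁻¹ :=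
  (measurable_from_nat (f := fun n : ℕ => ((n : ℝ))⁻¹)).comp
    (measurable_ncard.comp (measurable_set_iff.2 fun y => measurableSet_setOf.1 (measurableSet_openConn_holds x y)))

/-- `|C_x|⁻¹` is integrable under every finite measure. [folklore] -/
theorem integrable_inv_ncard_openCluster' {V : Type*} [Countable V] (x : V) (P : Measure (BondConfig V))
    [IsFiniteMeasure P] : Integrable (fun ω : BondConfig V => ((openCluster ω x).ncard : ℝ)⁻¹) P :=
  Integrable.of_bound (measurable_inv_ncard_openCluster' x).aestronglyMeasurable 1
    (Eventually.of_forall fun ω => by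
      rw [Real.norm_eq_abs, abs_of_nonneg (inv_nonneg.2 (Nat.cast_nonneg _))]
      exact Nat.cast_inv_le_one _)

/-! ### The cluster density is within `1/N` of a finite combination of increasing-event probabilities -/

section MeasureLevel

variable {V : Type*} [Countable V]

open Classical in
/-- **`|κ_P(x) − (1 − Σ_{k=2}^{N} P(|C_x| ≥ k)/((k−1)k))| ≤ 1/N`** for every probability measure `P` (`N ≥ 1`). [folklore] -/
theorem abs_integral_inv_ncard_sub_le (P : Measure (BondConfig V)) [IsProbabilityMeasure P] (x : V) (N : ℕ)
    (hN : 1 ≤ N) :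
    |∫ ω, ((openCluster ω x).ncard : ℝ)⁻¹ ∂P -
        (1 - ∑ k ∈ Finset.Icc 2 N, P.real (clusterSizeGe x k) / (((k : ℝ) - 1) * k))| ≤ 1 / N := by
  set g : BondConfig V → ℝ := fun ω =>
    1 - ∑ k ∈ Finset.Icc 2 N, (if ω ∈ clusterSizeGe x k then (1 : ℝ) / (((k : ℝ) - 1) * k) else 0) with hg
  have hterm : ∀ k ∈ Finset.Icc 2 N, Integrable
      (fun ω : BondConfig V => if ω ∈ clusterSizeGe x k then (1 : ℝ) / (((k : ℝ) - 1) * k) else 0) P ∧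
      ∫ ω, (if ω ∈ clusterSizeGe x k then (1 : ℝ) / (((k : ℝ) - 1) * k) else 0) ∂P =
        P.real (clusterSizeGe x k) / (((k : ℝ) - 1) * k) := by
    intro k _
    have hind : (fun ω : BondConfig V => if ω ∈ clusterSizeGe x k then (1 : ℝ) / (((k : ℝ) - 1) * k) else 0) =
        (clusterSizeGe x k).indicator fun _ => (1 : ℝ) / (((k : ℝ) - 1) * k) := by
      funext ω; exact (Set.indicator_apply (clusterSizeGe x k) (fun _ => (1 : ℝ) / (((k : ℝ) - 1) * k)) ω).symm
    rw [hind]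
    refine ⟨(integrable_const _).indicator (measurableSet_clusterSizeGe x k), ?_⟩
    rw [integral_indicator_const _ (measurableSet_clusterSizeGe x k), smul_eq_mul]
    ring
  have hgi : Integrable g P :=
    (integrable_const 1).sub (integrable_finsetSum _ fun k hk => (hterm k hk).1)
  have hgint : ∫ ω, g ω ∂P = 1 - ∑ k ∈ Finset.Icc 2 N, P.real (clusterSizeGe x k) / (((k : ℝ) - 1) * k) := by
    rw [hg, integral_sub (integrable_const 1) (integrable_finsetSum _ fun k hk => (hterm k hk).1),
      integral_const, smul_eq_mul, mul_one, probReal_univ, integral_finsetSum _ fun k hk => (hterm k hk).1]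
    exact congrArg (fun s => 1 - s) (Finset.sum_congr rfl fun k hk => (hterm k hk).2)
  rw [← hgint, ← integral_sub (integrable_inv_ncard_openCluster' x P) hgi]
  have hbound : ∀ᵐ ω ∂P, ‖((openCluster ω x).ncard : ℝ)⁻¹ - g ω‖ ≤ 1 / N :=
    Eventually.of_forall fun ω => by rw [Real.norm_eq_abs]; exact abs_inv_ncard_sub_le x ω N hN
  have h := norm_integral_le_of_norm_le_const hbound
  rwa [probReal_univ, mul_one, Real.norm_eq_abs] at h

end MeasureLevel

end Summit.CriticalPhenomena.PercolationContinuityZ3.Theorems.FK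

end
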